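import Summits.QuantumFields.YangMills.Theorems.ParabolicTrajectoryContinuumLimitOnTrajectoryUclTailsA
import Summits.QuantumFields.YangMills.Theorems.ParabolicTrajectoryContinuumLimitOnTrajectoryUclAlg
import Summits.QuantumFields.YangMills.Theorems.ParabolicTrajectoryContinuumLimitOnTrajectoryUclSums
import Summits.QuantumFields.YangMills.Theorems.ParabolicTrajectoryContinuumLimitOnTrajectoryStubTranslB
import Literature.MathematicalPhysics.QuantumFieldTheory.OSVectorNormGrowth

/-!
# Crux `ContinuumLimitOnTrajectory` (stmt-QuantumFields-10522), line `two-orbit-synchronisation` (seat c2):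
# tail terms of the core clustering estimate — part B: the two mechanisms

Helper file (`--supports stmt-QuantumFields-10522`) for the registered stub `stub_uclOfGap : UCLOfGap`, wave 2,
worker W2-TAILS. The eight TAIL terms of the nine-term expansion of `covc r sch k X Y = cD (X ⊗ Y) − cD X · cD Y`
(`…UclAlg`, pieces of `…UclDefs`, piece bounds of `…UclTailsA`) are disposed of by two mechanisms, recorded generically:

* FAR mechanism (`far_generic`): the crude covariance bound by sup norms (`norm_covc_le_crude`, from
  `norm_integral_mul_sub_le` and `norm_obsOf_le_schwartzNorm`: `‖covc X Y‖ ≤ 2 (2¹⁶C)^{n+m} a_k^{-4(n+m)} |X|_{8n} |Y|_{8m}`)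
  against a Schwartz tail `ρ_k^{-N}` of one factor, `ρ_k = rhoK sch k = √(a_k L_k)`; under `PolyVolumeGrowth`
  (`a_k⁻¹ ≤ (a_k L_k)^{N_v}` eventually) the product `a_k^{-4n} a_k^{-4m} ρ_k^{-N}` is `≤ a_k → 0` for `N = 2N_v(4n+4m+1)`
  (`far_smallness`, registered anchor `tailsB_far_smallness`);
* MID mechanism (`mid_generic`): the uniform UV bound `Transl.norm_curvDistribution_le_of_uuvb` (`UUVB`, ONE threshold in `k`
  for all test functions) on both terms of `covc` for off-diagonal `X`, `Y`, `X ⊗ Y` (`norm_covc_le_of_uuvb_at`, with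
  `|X ⊗ Y|_M ≤ 2^{M+1}|X|_M|Y|_M`, `M = (n+m)s`), against the decay `(t b₀/4)^{-(M+1)}` of a mid piece, which beats the growth
  `(2(1+t‖b‖))^M` of the translated factor: `≤ K/t` for `t ≥ 1` (`mid_bookkeeping`), hence `≤ δ` for `t ≥ t₀`.

Refs: Glimm–Jaffe 1987 §6.1, §19.7; Osterwalder–Schrader 1973 §2.
-/

set_option autoImplicit false

open scoped SchwartzMap
open MeasureTheory Filter Topology Set
open Literature.MathematicalPhysics.QuantumFieldTheory Literature.MathematicalPhysics.QuantumLattice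
open Literature.MathematicalPhysics.AQFT Literature.Probability.LatticeModels

noncomputable section

namespace Summit.QuantumFields.YangMills.Cruxes.ContinuumLimitOnTrajectory.TwoOrbitSynchronisation

namespace Tails

/-! ## Real-variable bookkeeping -/

/-- **Far smallness**: under `PolyVolumeGrowth`, for `N = 2 N_v (4n + 4m + 1)`, eventually
`a_k^{-4n} a_k^{-4m} ρ_k^{-N} ≤ a_k` (`ρ_k^N = (a_k L_k)^{N_v (4n+4m+1)} ≥ a_k^{-(4n+4m+1)}`). -/
theorem far_smallness {ι : Type} (sch : SpeciesScheme ι) (hvol : PolyVolumeGrowth sch) (n m : ℕ) :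
    ∃ N : ℕ, ∀ᶠ k in atTop, (sch.a k ^ (4 * n))⁻¹ * (sch.a k ^ (4 * m))⁻¹ * (rhoK sch k ^ N)⁻¹ ≤ sch.a k := by
  obtain ⟨Nv, -, hev⟩ := hvol
  refine ⟨2 * (Nv * (4 * n + 4 * m + 1)), ?_⟩
  have hL1 : ∀ᶠ k in atTop, (1 : ℝ) ≤ sch.a k * sch.L k := tendsto_atTop.1 sch.tendsto_L 1
  filter_upwards [hev, hL1] with k hk hV1
  have ha0 : 0 < sch.a k := sch.a_pos k
  have hV0 : 0 ≤ sch.a k * sch.L k := zero_le_one.trans hV1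
  have hrho : rhoK sch k ^ (2 * (Nv * (4 * n + 4 * m + 1))) = ((sch.a k * sch.L k) ^ Nv) ^ (4 * n + 4 * m + 1) := by
    rw [pow_mul, rhoK, Real.sq_sqrt hV0, pow_mul]
  have h1 : (sch.a k)⁻¹ ^ (4 * n + 4 * m + 1) ≤ ((sch.a k * sch.L k) ^ Nv) ^ (4 * n + 4 * m + 1) :=
    pow_le_pow_left₀ (inv_nonneg.2 ha0.le) hk _
  have h2 : 0 < (sch.a k)⁻¹ ^ (4 * n + 4 * m + 1) := pow_pos (inv_pos.2 ha0) _
  calc (sch.a k ^ (4 * n))⁻¹ * (sch.a k ^ (4 * m))⁻¹ * (rhoK sch k ^ (2 * (Nv * (4 * n + 4 * m + 1))))⁻¹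
      ≤ (sch.a k ^ (4 * n))⁻¹ * (sch.a k ^ (4 * m))⁻¹ * ((sch.a k)⁻¹ ^ (4 * n + 4 * m + 1))⁻¹ := by
        rw [hrho]
        exact mul_le_mul_of_nonneg_left (inv_anti₀ h2 h1) (by positivity)
    _ = sch.a k := by
        rw [inv_pow, inv_inv]
        field_simp
        ring

/-- **Mid bookkeeping**: for `t ≥ 1`, `(2(1 + tB))^M (t b₀/4)^{-(M+1)} ≤ (2(1+B))^M (4/b₀)^{M+1} t⁻¹`. -/
theorem mid_bookkeeping {b₀ B t : ℝ} (M : ℕ) (hb : 0 < b₀) (hB : 0 ≤ B) (ht : 1 ≤ t) :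
    (2 * (1 + t * B)) ^ M * (t * b₀ / 4)⁻¹ ^ (M + 1) ≤ (2 * (1 + B)) ^ M * (4 / b₀) ^ (M + 1) * t⁻¹ := by
  have ht0 : 0 < t := one_pos.trans_le ht
  have h1 : 2 * (1 + t * B) ≤ 2 * (1 + B) * t := by nlinarith
  have h2 : (2 * (1 + t * B)) ^ M ≤ (2 * (1 + B)) ^ M * t ^ M := by
    rw [← mul_pow]
    exact pow_le_pow_left₀ (by positivity) h1 M
  have h3 : (t * b₀ / 4)⁻¹ ^ (M + 1) = (4 / b₀) ^ (M + 1) * (t ^ M * t)⁻¹ := by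
    rw [← pow_succ, ← inv_pow, ← mul_pow]
    congr 1
    field_simp
  have h4 : t ^ M * (t ^ M * t)⁻¹ = t⁻¹ := by
    rw [mul_inv, ← mul_assoc, mul_inv_cancel₀ (pow_ne_zero M ht0.ne'), one_mul]
  calc (2 * (1 + t * B)) ^ M * (t * b₀ / 4)⁻¹ ^ (M + 1)
      ≤ (2 * (1 + B)) ^ M * t ^ M * (t * b₀ / 4)⁻¹ ^ (M + 1) := mul_le_mul_of_nonneg_right h2 (by positivity)
    _ = (2 * (1 + B)) ^ M * (4 / b₀) ^ (M + 1) * (t ^ M * (t ^ M * t)⁻¹) := by rw [h3]; ring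
    _ = (2 * (1 + B)) ^ M * (4 / b₀) ^ (M + 1) * t⁻¹ := by rw [h4]

/-! ## The FAR mechanism: sup norms -/

section Far

variable {G : Type} [Group G] [TopologicalSpace G] [IsTopologicalGroup G] [CompactSpace G]
  [MeasurableSpace G] [BorelSpace G]

/-- Sup norm of the lattice observable for `a_k ≤ 1`: `‖obsOf F‖_∞ ≤ (2¹⁶|C|)^p a_k^{-4p} |F|_{8p}`. -/
theorem norm_obsOf_le_simple (r : LatticeRep G) (sch : SpeciesScheme (YMSpecies G)) (k p : ℕ) {C : ℝ}
    (hC : ∀ x U, |cw r sch k x U| ≤ C) (ha : sch.a k ≤ 1) (F : 𝓢((Fin p → EuclideanSpace ℝ (Fin 4)), ℂ))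
    (U : GaugeConfig 4 (sch.side k) G) :
    ‖obsOf r sch k p F U‖ ≤ (2 ^ 16 * |C|) ^ p * (sch.a k ^ (4 * p))⁻¹ * schwartzNorm (8 * p) F := by
  refine (norm_obsOf_le_schwartzNorm r sch k p hC F U).trans ?_
  have ha0 := (sch.a_pos k).le
  have hF := schwartzNorm_nonneg (8 * p) F
  have h1 : (2 * (sch.a k + 1)) ^ (4 * p) ≤ (4 : ℝ) ^ (4 * p) := pow_le_pow_left₀ (by positivity) (by linarith) _
  have h2 : (4 : ℝ) ^ (4 * p) * 2 ^ (8 * p) = (2 ^ 16) ^ p := by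
    rw [pow_mul, pow_mul, ← mul_pow]
    norm_num
  calc |C| ^ p * ((sch.a k ^ (4 * p))⁻¹ * (2 * (sch.a k + 1)) ^ (4 * p) * (2 ^ (8 * p) * schwartzNorm (8 * p) F))
      ≤ |C| ^ p * ((sch.a k ^ (4 * p))⁻¹ * 4 ^ (4 * p) * (2 ^ (8 * p) * schwartzNorm (8 * p) F)) :=
        mul_le_mul_of_nonneg_left (mul_le_mul_of_nonneg_right
          (mul_le_mul_of_nonneg_left h1 (inv_nonneg.2 (pow_nonneg ha0 _))) (by positivity)) (pow_nonneg (abs_nonneg C) _)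
    _ = (2 ^ 16 * |C|) ^ p * (sch.a k ^ (4 * p))⁻¹ * schwartzNorm (8 * p) F := by
        rw [mul_pow, ← h2]; ring

/-- **The crude bound by sup norms** (`a_k ≤ 1`):
`‖covc X Y‖ ≤ 2 · ((2¹⁶|C|)^n a_k^{-4n} |X|_{8n}) · ((2¹⁶|C|)^m a_k^{-4m} |Y|_{8m})`. -/
theorem norm_covc_le_crude (r : LatticeRep G) (sch : SpeciesScheme (YMSpecies G)) {C : ℝ}
    (hC : ∀ k x U, |cw r sch k x U| ≤ C) {k : ℕ} (ha : sch.a k ≤ 1) {n m : ℕ} (X : 𝓢((Fin n → EuclideanSpace ℝ (Fin 4)), ℂ))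
    (Y : 𝓢((Fin m → EuclideanSpace ℝ (Fin 4)), ℂ)) :
    ‖covc r sch k X Y‖ ≤ 2 * ((2 ^ 16 * |C|) ^ n * (sch.a k ^ (4 * n))⁻¹ * schwartzNorm (8 * n) X) *
      ((2 ^ 16 * |C|) ^ m * (sch.a k ^ (4 * m))⁻¹ * schwartzNorm (8 * m) Y) := by
  unfold covc
  rw [curvDistribution_appendTensor, curvDistribution_eq_integral_obsOf, curvDistribution_eq_integral_obsOf]
  have ha0 := (sch.a_pos k).le
  have hX := schwartzNorm_nonneg (8 * n) X
  have h0 : 0 ≤ (2 ^ 16 * |C|) ^ n * (sch.a k ^ (4 * n))⁻¹ * schwartzNorm (8 * n) X := by positivity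
  exact norm_integral_mul_sub_le (μW r sch k) h0 (norm_obsOf_le_simple r sch k n (hC k) ha X)
    (norm_obsOf_le_simple r sch k m (hC k) ha Y)

/-- **The FAR mechanism.** If the product of the `8n`- and `8m`-Schwartz norms of the two `k`-dependent factors is
`≤ K ρ_k^{-N}` with the `N` of `far_smallness`, the truncated functional is eventually `≤ δ`. -/
theorem far_generic (r : LatticeRep G) (sch : SpeciesScheme (YMSpecies G)) {C : ℝ} (hC : ∀ k x U, |cw r sch k x U| ≤ C)
    {n m N : ℕ} (hN : ∀ᶠ k in atTop, (sch.a k ^ (4 * n))⁻¹ * (sch.a k ^ (4 * m))⁻¹ * (rhoK sch k ^ N)⁻¹ ≤ sch.a k)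
    (X : ℕ → 𝓢((Fin n → EuclideanSpace ℝ (Fin 4)), ℂ)) (Y : ℕ → 𝓢((Fin m → EuclideanSpace ℝ (Fin 4)), ℂ)) {K : ℝ} (hK : 0 ≤ K)
    (hXY : ∀ k, 1 ≤ rhoK sch k → schwartzNorm (8 * n) (X k) * schwartzNorm (8 * m) (Y k) ≤ K * (rhoK sch k ^ N)⁻¹)
    {δ : ℝ} (hδ : 0 < δ) : ∀ᶠ k in atTop, ‖covc r sch k (X k) (Y k)‖ ≤ δ := by
  set K₀ : ℝ := 2 * ((2 ^ 16 * |C|) ^ n * (2 ^ 16 * |C|) ^ m) * K with hK₀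
  have hK₀0 : 0 ≤ K₀ := by positivity
  have h1 : ∀ᶠ k in atTop, sch.a k ≤ 1 := (sch.tendsto_a.eventually_lt_const zero_lt_one).mono fun k hk => hk.le
  have h2 : ∀ᶠ k in atTop, sch.a k ≤ δ / (K₀ + 1) :=
    (sch.tendsto_a.eventually_lt_const (by positivity)).mono fun k hk => hk.le
  have h3 : ∀ᶠ k in atTop, 1 ≤ rhoK sch k := tendsto_atTop.1 (tendsto_rhoK_atTop sch) 1
  filter_upwards [hN, h1, h2, h3] with k hk ha1 haδ hρ
  have ha0 := (sch.a_pos k).le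
  calc ‖covc r sch k (X k) (Y k)‖
      ≤ 2 * ((2 ^ 16 * |C|) ^ n * (sch.a k ^ (4 * n))⁻¹ * schwartzNorm (8 * n) (X k)) *
          ((2 ^ 16 * |C|) ^ m * (sch.a k ^ (4 * m))⁻¹ * schwartzNorm (8 * m) (Y k)) := norm_covc_le_crude r sch hC ha1 _ _
    _ = 2 * ((2 ^ 16 * |C|) ^ n * (2 ^ 16 * |C|) ^ m) * ((sch.a k ^ (4 * n))⁻¹ * (sch.a k ^ (4 * m))⁻¹) *
          (schwartzNorm (8 * n) (X k) * schwartzNorm (8 * m) (Y k)) := by ring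
    _ ≤ 2 * ((2 ^ 16 * |C|) ^ n * (2 ^ 16 * |C|) ^ m) * ((sch.a k ^ (4 * n))⁻¹ * (sch.a k ^ (4 * m))⁻¹) *
          (K * (rhoK sch k ^ N)⁻¹) := mul_le_mul_of_nonneg_left (hXY k hρ) (by positivity)
    _ = K₀ * ((sch.a k ^ (4 * n))⁻¹ * (sch.a k ^ (4 * m))⁻¹ * (rhoK sch k ^ N)⁻¹) := by rw [hK₀]; ring
    _ ≤ K₀ * sch.a k := mul_le_mul_of_nonneg_left hk hK₀0
    _ ≤ K₀ * (δ / (K₀ + 1)) := mul_le_mul_of_nonneg_left haδ hK₀0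
    _ = δ * (K₀ / (K₀ + 1)) := by ring
    _ ≤ δ * 1 := mul_le_mul_of_nonneg_left ((div_le_one (by positivity)).2 (by linarith)) hδ.le
    _ = δ := mul_one δ

end Far

/-! ## The MID mechanism: uniform UV bounds -/

section Mid

variable {G : Type} [Group G] [TopologicalSpace G] [IsTopologicalGroup G] [CompactSpace G]
  [MeasurableSpace G] [BorelSpace G]

/-- **`covc` under the uniform UV bound** at a step `k` where it holds: for off-diagonal `X`, `Y`, `X ⊗ Y`,
`‖covc X Y‖ ≤ K_cd |X|_M |Y|_M` with `M = (n+m)s` (`|X ⊗ Y|_M ≤ 2^{M+1} |X|_M |Y|_M`). -/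
theorem norm_covc_le_of_uuvb_at (r : LatticeRep G) (sch : SpeciesScheme (YMSpecies G)) {s : ℕ} {α β : ℝ} {k : ℕ}
    (hk : ∀ (p : ℕ) (F : 𝓢((Fin p → EuclideanSpace ℝ (Fin 4)), ℂ)), IsOffDiagonal F →
      ‖curvDistribution r sch k p F‖ ≤ (Fintype.card PlaqIdx : ℝ) ^ p * (α * (p.factorial : ℝ) ^ β * schwartzNorm (p * s) F))
    {n m : ℕ} {X : 𝓢((Fin n → EuclideanSpace ℝ (Fin 4)), ℂ)} {Y : 𝓢((Fin m → EuclideanSpace ℝ (Fin 4)), ℂ)}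
    (hX : IsOffDiagonal X) (hY : IsOffDiagonal Y)
    (hXY : IsOffDiagonal (X.appendTensor Y)) :
    ‖covc r sch k X Y‖ ≤
      ((Fintype.card PlaqIdx : ℝ) ^ (n + m) * |α| * ((n + m).factorial : ℝ) ^ β * 2 ^ ((n + m) * s + 1) +
        (Fintype.card PlaqIdx : ℝ) ^ n * |α| * (n.factorial : ℝ) ^ β *
          ((Fintype.card PlaqIdx : ℝ) ^ m * |α| * (m.factorial : ℝ) ^ β)) *
      schwartzNorm ((n + m) * s) X * schwartzNorm ((n + m) * s) Y := by
  set c : ℝ := (Fintype.card PlaqIdx : ℝ) with hc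
  have hc0 : 0 ≤ c := Nat.cast_nonneg _
  have hXn := schwartzNorm_nonneg ((n + m) * s) X
  have hYn := schwartzNorm_nonneg ((n + m) * s) Y
  have hf : ∀ q : ℕ, 0 ≤ ((q.factorial : ℕ) : ℝ) ^ β := fun q => Real.rpow_nonneg (Nat.cast_nonneg _) β
  have h1 : ‖curvDistribution r sch k (n + m) (X.appendTensor Y)‖ ≤
      c ^ (n + m) * |α| * ((n + m).factorial : ℝ) ^ β * 2 ^ ((n + m) * s + 1) *
        schwartzNorm ((n + m) * s) X * schwartzNorm ((n + m) * s) Y := by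
    refine (hk _ _ hXY).trans ?_
    have h2 := Literature.MathematicalPhysics.QuantumFieldTheory.schwartzNorm_appendTensor_le X Y ((n + m) * s)
    calc c ^ (n + m) * (α * ((n + m).factorial : ℝ) ^ β * schwartzNorm ((n + m) * s) (X.appendTensor Y))
        ≤ c ^ (n + m) * (|α| * ((n + m).factorial : ℝ) ^ β *
            (2 ^ ((n + m) * s + 1) * schwartzNorm ((n + m) * s) X * schwartzNorm ((n + m) * s) Y)) := by
          refine mul_le_mul_of_nonneg_left ?_ (pow_nonneg hc0 _)
          exact mul_le_mul (mul_le_mul_of_nonneg_right (le_abs_self α) (hf _)) h2 (schwartzNorm_nonneg _ _)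
            (mul_nonneg (abs_nonneg _) (hf _))
      _ = _ := by ring
  have h3 : ‖curvDistribution r sch k n X‖ ≤ c ^ n * |α| * (n.factorial : ℝ) ^ β * schwartzNorm ((n + m) * s) X := by
    refine (hk _ _ hX).trans ?_
    have hmono : schwartzNorm (n * s) X ≤ schwartzNorm ((n + m) * s) X :=
      schwartzNorm_mono (Nat.mul_le_mul_right s (Nat.le_add_right n m)) X
    calc c ^ n * (α * (n.factorial : ℝ) ^ β * schwartzNorm (n * s) X)
        ≤ c ^ n * (|α| * (n.factorial : ℝ) ^ β * schwartzNorm ((n + m) * s) X) := by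
          refine mul_le_mul_of_nonneg_left ?_ (pow_nonneg hc0 _)
          exact mul_le_mul (mul_le_mul_of_nonneg_right (le_abs_self α) (hf _)) hmono (schwartzNorm_nonneg _ _)
            (mul_nonneg (abs_nonneg _) (hf _))
      _ = _ := by ring
  have h4 : ‖curvDistribution r sch k m Y‖ ≤ c ^ m * |α| * (m.factorial : ℝ) ^ β * schwartzNorm ((n + m) * s) Y := by
    refine (hk _ _ hY).trans ?_
    have hmono : schwartzNorm (m * s) Y ≤ schwartzNorm ((n + m) * s) Y :=
      schwartzNorm_mono (Nat.mul_le_mul_right s (Nat.le_add_left m n)) Y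
    calc c ^ m * (α * (m.factorial : ℝ) ^ β * schwartzNorm (m * s) Y)
        ≤ c ^ m * (|α| * (m.factorial : ℝ) ^ β * schwartzNorm ((n + m) * s) Y) := by
          refine mul_le_mul_of_nonneg_left ?_ (pow_nonneg hc0 _)
          exact mul_le_mul (mul_le_mul_of_nonneg_right (le_abs_self α) (hf _)) hmono (schwartzNorm_nonneg _ _)
            (mul_nonneg (abs_nonneg _) (hf _))
      _ = _ := by ring
  have h5 : 0 ≤ c ^ n * |α| * (n.factorial : ℝ) ^ β * schwartzNorm ((n + m) * s) X :=
    mul_nonneg (mul_nonneg (mul_nonneg (pow_nonneg hc0 _) (abs_nonneg _)) (hf _)) hXn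
  calc ‖covc r sch k X Y‖ ≤ ‖curvDistribution r sch k (n + m) (X.appendTensor Y)‖ +
        ‖curvDistribution r sch k n X‖ * ‖curvDistribution r sch k m Y‖ := by
        unfold covc
        exact (norm_sub_le _ _).trans (by rw [norm_mul])
    _ ≤ _ := add_le_add h1 (mul_le_mul h3 h4 (norm_nonneg _) h5)
    _ = _ := by ring

/-- **The MID mechanism.** Off-diagonal `(t, k)`-dependent factors whose `M`-norm product decays like
`K (2(1+tB))^M (t b₀/4)^{-(M+1)}` give a truncated functional `≤ δ` for `t ≥ t₀`, at every step of the `UUVB` threshold. -/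
theorem mid_generic (r : LatticeRep G) (sch : SpeciesScheme (YMSpecies G)) {s : ℕ} {α β : ℝ}
    (hk : ∀ᶠ k in atTop, ∀ (p : ℕ) (F : 𝓢((Fin p → EuclideanSpace ℝ (Fin 4)), ℂ)), IsOffDiagonal F →
      ‖curvDistribution r sch k p F‖ ≤ (Fintype.card PlaqIdx : ℝ) ^ p * (α * (p.factorial : ℝ) ^ β * schwartzNorm (p * s) F))
    {n m : ℕ} (X : ℝ → ℕ → 𝓢((Fin n → EuclideanSpace ℝ (Fin 4)), ℂ)) (Y : ℝ → ℕ → 𝓢((Fin m → EuclideanSpace ℝ (Fin 4)), ℂ))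
    (hX : ∀ t k, IsOffDiagonal (X t k)) (hY : ∀ t k, IsOffDiagonal (Y t k))
    (hXY : ∀ t k, IsOffDiagonal ((X t k).appendTensor (Y t k)))
    {K B b₀ : ℝ} (hK : 0 ≤ K) (hB : 0 ≤ B) (hb₀ : 0 < b₀)
    (hbd : ∀ t k, 1 ≤ t → schwartzNorm ((n + m) * s) (X t k) * schwartzNorm ((n + m) * s) (Y t k) ≤
      K * ((2 * (1 + t * B)) ^ ((n + m) * s) * (t * b₀ / 4)⁻¹ ^ ((n + m) * s + 1)))
    {δ : ℝ} (hδ : 0 < δ) :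
    ∃ t₀ : ℝ, ∀ t : ℝ, t₀ ≤ t → ∀ᶠ k in atTop, ‖covc r sch k (X t k) (Y t k)‖ ≤ δ := by
  set c : ℝ := (Fintype.card PlaqIdx : ℝ) with hc
  set M : ℕ := (n + m) * s with hM
  set Kcd : ℝ := c ^ (n + m) * |α| * ((n + m).factorial : ℝ) ^ β * 2 ^ (M + 1) +
    c ^ n * |α| * (n.factorial : ℝ) ^ β * (c ^ m * |α| * (m.factorial : ℝ) ^ β) with hKcd
  have hc0 : 0 ≤ c := Nat.cast_nonneg _
  have hKcd0 : 0 ≤ Kcd := by positivity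
  set K₁ : ℝ := Kcd * (K * ((2 * (1 + B)) ^ M * (4 / b₀) ^ (M + 1))) with hK₁
  have hK₁0 : 0 ≤ K₁ := by positivity
  refine ⟨max 1 (K₁ / δ), fun t ht => hk.mono fun k hkk => ?_⟩
  have ht1 : 1 ≤ t := le_of_max_le_left ht
  have ht0 : 0 < t := one_pos.trans_le ht1
  have htK : K₁ / δ ≤ t := le_of_max_le_right ht
  calc ‖covc r sch k (X t k) (Y t k)‖ ≤ Kcd * schwartzNorm M (X t k) * schwartzNorm M (Y t k) :=
        norm_covc_le_of_uuvb_at r sch hkk (hX t k) (hY t k) (hXY t k)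
    _ = Kcd * (schwartzNorm M (X t k) * schwartzNorm M (Y t k)) := mul_assoc _ _ _
    _ ≤ Kcd * (K * ((2 * (1 + t * B)) ^ M * (t * b₀ / 4)⁻¹ ^ (M + 1))) := mul_le_mul_of_nonneg_left (hbd t k ht1) hKcd0
    _ ≤ Kcd * (K * ((2 * (1 + B)) ^ M * (4 / b₀) ^ (M + 1) * t⁻¹)) :=
        mul_le_mul_of_nonneg_left (mul_le_mul_of_nonneg_left (mid_bookkeeping M hb₀ hB ht1) hK) hKcd0
    _ = K₁ / t := by rw [hK₁, div_eq_mul_inv]; ring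
    _ ≤ δ := by
        rw [div_le_iff₀ ht0]
        rw [div_le_iff₀ hδ] at htK
        linarith

end Mid

end Tails

/-! ## Registered anchor of this file -/

/-- **Registered anchor — far smallness under polynomial volume growth**: for every pair of arities there is `N` with
`a_k^{-4n} a_k^{-4m} ρ_k^{-N} ≤ a_k` eventually (`ρ_k = √(a_k L_k)`), which is what makes the sup-norm bound of the far tail
terms (`a_k^{-4(n+m)}` face multiplicity against the Schwartz tail `ρ_k^{-N}` beyond the window radius) tend to zero. -/
theorem tailsB_far_smallness :
    ∀ {ι : Type} (sch : SpeciesScheme ι), PolyVolumeGrowth sch → ∀ (n m : ℕ),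
      ∃ N : ℕ, ∀ᶠ k in atTop, (sch.a k ^ (4 * n))⁻¹ * (sch.a k ^ (4 * m))⁻¹ * (rhoK sch k ^ N)⁻¹ ≤ sch.a k := by
  intro ι sch hvol n m
  exact Tails.far_smallness sch hvol n m

end Summit.QuantumFields.YangMills.Cruxes.ContinuumLimitOnTrajectory.TwoOrbitSynchronisation

end
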